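import Literature.Algebra.EuclideanDomain.IntProdIntSmallestAlgorithm
import Literature.Algebra.EuclideanDomain.EuclideanDomainIffTransfiniteConstruction
import HarnessLib

/-!
# The Euclidean order type of a product: `e(R) + e(S) ≤ e(R × S)` (Clark 2015, Product Theorem, lower bound);
# products with a non-field Euclidean domain factor need transfinite algorithms

Topic `Literature/Algebra/EuclideanDomain`, namespace `Literature.Algebra.EuclideanDomain`.  THEOREMS ONLY (no `def`, no
instance, no named fact), all proved, in the vocabulary of `TransfiniteSmallestAlgorithm.lean` (`samuelSet R α = A_α`,
`samuelRank = θ`) and `EuclideanOrderTypeIndecomposable.lean` (the Euclidean order type written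
`e(R) = ⨆ z, ((θ z − 1) + 1)`; Clark's bottom Euclidean function is `φ_R = θ − 1` on `R ∖ 0`).

## Source (read at the page)

P. L. Clark, *A note on Euclidean order types*, Order **32** (2015) 157–178 [Clark2015EuclideanOrderTypes] (materialised
`paper:arxiv-1208.0977`; numbering of the arXiv version), VERBATIM, §2.8 Theorem 22 (Product Theorem): «Let `R₁, …, R_n`
be Euclidean rings. a) The ring `∏ Rᵢ` is Euclidean iff `Rᵢ` is Euclidean for all `i`. b) If the equivalent conditions
of part a) hold, then `e(R₁) + … + e(R_n) ≤ e(∏ Rᵢ) ≤ e(R₁) ⊕ … ⊕ e(R_n)`.»  Proof of the lower bound: «Induction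
reduces us to the case `n = 2`. Put `R = R₁ × R₂`. … Let `b = (0,1)`, so `R/(b) = R₁` and thus … `φ_R(b) = e(R₁)`.  For
`y ∈ R₂`, `b = (0,1) ∣ (0,y)`, so … `φ_R((0,1)) ≤ φ_R((0,y))`.  By Lemma 21 [ordinal subtraction] we may put
`ψ(y) = −φ_R((0,1)) + φ_R((0,y))`.  We claim `ψ : R₂ → Ord` is a Euclidean function. Granting this … `ψ ≥ φ_{R₂}`, so
`e(R) = φ_R((0,0)) = φ_R((0,1)) + ψ(0) ≥ e(R₁) + e(R₂)`.  proof of claim: Let `x ∈ R₂`, `y ∈ R₂•` … there are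
`q = (q₁,q₂)`, `r = (r₁,r₂) ∈ R` such that `(0,x) = q(0,y) + r = (r₁, q₂y + r₂)` and either `r = 0` or
`φ_R(r) < φ_R((0,y))`.  Thus `r₁ = 0` and `x = q₂y + r₂` … we may subtract `φ_R(0,1)` — on the left! — from both sides».
Theorem 25 (c): for `R′ = ∏_{i=1}^r Rᵢ` a product of Euclidean domains [that are not fields], «`e(R′) ≥ rω`»;
Corollary 26 (Fletcher) «A Euclidean ring `R` with `e(R) = ω` is a domain.»

## What is formalised (two factors; `R`, `S` non-trivial, exhausted by their transfinite constructions, same universe)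

* §1 `B := θ(0, 1) = ⨆_{c ∈ R} (θ(c) + 1)` («`φ_R(b) = e(R₁)`», `samuelRank_zero_mk_of_isUnit`), `B ≤ θ(0, y)` for
  `y ≠ 0` (`samuelRank_zero_one_le`), and Clark's claim in Samuel's normalisation: `ψ′(y) = 1 + (θ(0,y) − B)` (`y ≠ 0`),
  `ψ′(0) = 0` is an algorithm on `S`, whence **`θ_S(y) − 1 ≤ θ(0, y) − B`** (`samuelRank_sub_one_le_sub`).
* §2 **`e(R) + e(S) ≤ e(R × S)`** (**`iSup_samuelRank_add_iSup_samuelRank_le_prod`**), assembled from `e(R) ≤ B − 1` and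
  `e(S) ≤ ⨆_y ((θ(0,y) − B) + 1)` with `(B − 1) + (θ(0,y) − B) = θ(0,y) − 1` and the continuity of `(B − 1) + ·`.
* §3 consequences: if `e(S) ≥ ω` then `θ(u, 0) ≥ ω` for every unit `u` of `R` and **`R × S` admits no `ℕ`-valued algorithm**,
  in Samuel's and in Motzkin's form (`not_exists_algorithm_nat_of_omega0_le_iSup`,
  `not_exists_euclideanFunction_of_omega0_le_iSup`); a Mathlib `EuclideanDomain` that is not a field has `e ≥ ω`
  (`omega0_le_iSup_samuelRank_of_euclideanDomain`, via `e = ω^a` of `EuclideanOrderTypeIndecomposable.lean`), so **a product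
  `R × S` with `S` a non-field Euclidean domain is Euclidean for NO ordinary algorithm** although it has an ordinal-valued one
  (`not_exists_algorithm_nat_prod_of_euclideanDomain`, `exists_ordinal_algorithm_prod_of_euclideanDomain`) — Samuel's
  «transfinite valued algorithms … unavoidable in the case `ℤ × ℤ`» for every such product (`ℤ × ℤ[i]`, `k[X] × k[X]`, …);
  and for two non-field Euclidean domains `ω + ω ≤ e(R × S)` (Thm. 25 (c), `r = 2`).
-- TODO(general form): the upper bound `e(R × S) ≤ e(R) ⊕ e(S)` (Hessenberg–Brookfield natural sum; Mathlib has no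
-- `Ordinal.nadd` at this pin) and `n` factors are not formalised.

## Mathlib / tree search

Mathlib: ordinal left-subtraction `a - b` (`Ordinal.sub_le`, `Ordinal.lt_sub`, `Ordinal.le_sub_of_le`,
`Ordinal.add_sub_cancel_of_le`, `Ordinal.sub_eq_of_add_eq`) is exactly Clark's Lemma 21 «`−α + β`»; `Ordinal.add_iSup`.
Tree: `IntProdIntSmallestAlgorithm.lean` (`samuelRank_mk_zero_of_isUnit`, `samuelRank_map_ringEquiv` — the case `ℤ × ℤ`
with equality `e = ω + ω`), `TransfiniteSmallestAlgorithm.lean` (`samuelRank_isAlgorithm`, `samuelRank_le_apply`,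
`samuelRank_le_natCast`, `samuelRank_le_samuelRank_mul`), `ProductOfEuclideanRings.lean` (`Prod.forall_exists_mem_samuelSet`),
`EuclideanOrderTypeIndecomposable.lean` (`iSup_samuelRank_eq_omega0_opow`), `EuclideanDomainIffTransfiniteConstruction.lean`
(`forall_exists_mem_samuelSet_of_euclideanDomain`).
-/

namespace Literature.Algebra.EuclideanDomain

universe u

open Ordinal

section Product

variable {R S : Type u} [CommRing R] [CommRing S]

/-! ## §1 `B = θ(0,1)`, `B ≤ θ(0,y)`, and Clark's `ψ` -/

/-- **«`φ_R(b) = e(R₁)`» for `b = (0, u)`**, `u` a unit of `S`: `θ(0, u) = ⨆_{c ∈ R} (θ(c) + 1)` (the classes mod `(0, u)`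
are `R × S ∕ (0, u) ≅ R`). [cite: Clark2015EuclideanOrderTypes, Thm. 19 (b) and proof of Thm. 22] -/
theorem samuelRank_zero_mk_of_isUnit [Nontrivial S] {u : S} (hu : IsUnit u)
    (hR : ∀ x : R, ∃ α : Ordinal.{u}, x ∈ samuelSet R α) (hS : ∀ y : S, ∃ α : Ordinal.{u}, y ∈ samuelSet S α) :
    samuelRank (((0 : R), u) : R × S) = ⨆ c : R, (samuelRank c + 1) := by
  have h : (RingEquiv.prodComm : S × R ≃+* R × S) (u, 0) = ((0 : R), u) := rfl
  rw [← h, samuelRank_map_ringEquiv _ (Prod.forall_exists_mem_samuelSet hS hR _), samuelRank_mk_zero_of_isUnit hu hR]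

/-- **«`b = (0,1) ∣ (0,y)`, so `φ_R((0,1)) ≤ φ_R((0,y))`»**: `θ(0, 1) ≤ θ(0, y)` for `y ≠ 0` (`θ` is isotone for
divisibility, Prop. 4 (a)). [cite: Clark2015EuclideanOrderTypes, proof of Thm. 22; Samuel1971, Prop. 4 (a) (p. 284)] -/
theorem samuelRank_zero_one_le (hR : ∀ x : R, ∃ α : Ordinal.{u}, x ∈ samuelSet R α)
    (hS : ∀ y : S, ∃ α : Ordinal.{u}, y ∈ samuelSet S α) {y : S} (hy : y ≠ 0) :
    samuelRank (((0 : R), (1 : S)) : R × S) ≤ samuelRank (((0 : R), y) : R × S) := by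
  have h : (((0 : R), (1 : S)) : R × S) * ((1 : R), y) = ((0 : R), y) := by simp
  have := samuelRank_le_samuelRank_mul (a := (((0 : R), (1 : S)) : R × S)) (c := (((1 : R), y) : R × S))
    (by rw [h]; exact Prod.forall_exists_mem_samuelSet hR hS _) (by rw [h]; simp [hy])
  rwa [h] at this

/-- **Clark's claim, in Samuel's normalisation**: with `B = θ(0,1)`, the map `ψ′(y) = 1 + (θ(0,y) − B)` (`y ≠ 0`),
`ψ′(0) = 0` is an algorithm on `S` — dividing `(0,x)` by `(0,y)` in `R × S` leaves a remainder `(0, r₂)`, and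
`B + ·` is cancelled «on the left!» (`Ordinal.lt_sub`) — hence, `θ_S` being the smallest algorithm,
**`θ_S(y) − 1 ≤ θ(0, y) − B`** for `y ≠ 0` («`ψ ≥ φ_{R₂}`»). [cite: Clark2015EuclideanOrderTypes, proof of Thm. 22 (claim)] -/
theorem samuelRank_sub_one_le_sub (hR : ∀ x : R, ∃ α : Ordinal.{u}, x ∈ samuelSet R α)
    (hS : ∀ y : S, ∃ α : Ordinal.{u}, y ∈ samuelSet S α) {y : S} (hy : y ≠ 0) :
    samuelRank y - 1 ≤
      samuelRank (((0 : R), y) : R × S) - samuelRank (((0 : R), (1 : S)) : R × S) := by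
  classical
  set B : Ordinal.{u} := samuelRank (((0 : R), (1 : S)) : R × S) with hB
  have hRS := Prod.forall_exists_mem_samuelSet hR hS
  -- Clark's `ψ`, shifted: `ψ′ y = 1 + (θ(0,y) − B)` for `y ≠ 0`, `ψ′ 0 = 0`
  have hψ : ∀ a b : S, b ≠ 0 → ∃ q r : S, a = b * q + r ∧
      (fun s : S ↦ if s = 0 then (0 : Ordinal.{u}) else 1 + (samuelRank (((0 : R), s) : R × S) - B)) r <
        (fun s : S ↦ if s = 0 then (0 : Ordinal.{u}) else 1 + (samuelRank (((0 : R), s) : R × S) - B)) b := by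
    intro a b hb
    obtain ⟨q, r, hqr, hlt⟩ := samuelRank_isAlgorithm hRS ((0 : R), a) ((0 : R), b) (by simp [hb])
    have hr1 : r.1 = 0 := by
      have := congrArg Prod.fst hqr
      simpa using this.symm
    have hr2 : a = b * q.2 + r.2 := by
      have := congrArg Prod.snd hqr
      simpa using this
    refine ⟨q.2, r.2, hr2, ?_⟩
    by_cases hr0 : r.2 = 0
    · beta_reduce
      rw [if_pos hr0, if_neg hb]
      exact zero_lt_one.trans_le le_self_add
    · beta_reduce
      rw [if_neg hr0, if_neg hb]
      have hr : r = ((0 : R), r.2) := Prod.ext hr1 rfl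
      rw [hr] at hlt
      have hBr : B ≤ samuelRank (((0 : R), r.2) : R × S) := samuelRank_zero_one_le hR hS hr0
      exact (add_lt_add_iff_left 1).2 (Ordinal.lt_sub.2 (by rwa [Ordinal.add_sub_cancel_of_le hBr]))
  have hle := samuelRank_le_apply _ hψ y
  beta_reduce at hle
  rw [if_neg hy] at hle
  exact Ordinal.sub_le.2 hle

/-! ## §2 The Product Theorem, lower bound: `e(R) + e(S) ≤ e(R × S)` -/

/-- `e(R) ≤ B − 1` where `B = θ(0,1) = ⨆_c (θ(c) + 1)` («`φ_R(b) = e(R₁)`»; here an inequality suffices: every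
`(θ c − 1) + 1` is `≤ B − 1`, using `B ≥ θ(1) + 1 = 2`). [cite: Clark2015EuclideanOrderTypes, Thm. 19 (b) and proof of Thm. 22] -/
theorem iSup_samuelRank_le_samuelRank_zero_one_sub_one [Nontrivial R] [Nontrivial S]
    (hR : ∀ x : R, ∃ α : Ordinal.{u}, x ∈ samuelSet R α) (hS : ∀ y : S, ∃ α : Ordinal.{u}, y ∈ samuelSet S α) :
    (⨆ x : R, (samuelRank x - 1 + 1)) ≤ samuelRank (((0 : R), (1 : S)) : R × S) - 1 := by
  rw [samuelRank_zero_mk_of_isUnit isUnit_one hR hS]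
  set L : Ordinal.{u} := ⨆ c : R, (samuelRank c + 1) with hL
  have h2 : 2 ≤ L := by
    have := Ordinal.le_iSup (fun c : R ↦ samuelRank c + 1) 1
    rwa [samuelRank_eq_one_iff_isUnit.2 isUnit_one, one_add_one_eq_two] at this
  have h1 : 1 ≤ L := (one_le_two).trans h2
  refine Ordinal.iSup_le fun c ↦ (Ordinal.le_sub_of_le h1).2 ?_
  rcases eq_or_ne (samuelRank c) 0 with h0 | h0
  · rw [h0, Ordinal.zero_sub, zero_add, one_add_one_eq_two]
    exact h2
  · rw [← add_assoc, Ordinal.add_sub_cancel_of_le (Order.one_le_iff_ne_zero.2 h0)]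
    exact Ordinal.le_iSup (fun c : R ↦ samuelRank c + 1) c

/-- `e(S) ≤ ⨆_y ((θ(0,y) − B) + 1)` («`ψ ≥ φ_{R₂}`», so `e(R₂) ≤ ψ(0)` in Clark's convention `ψ(0) = sup ψ + 1`).
[cite: Clark2015EuclideanOrderTypes, proof of Thm. 22] -/
theorem iSup_samuelRank_le_iSup_sub_add_one
    (hR : ∀ x : R, ∃ α : Ordinal.{u}, x ∈ samuelSet R α) (hS : ∀ y : S, ∃ α : Ordinal.{u}, y ∈ samuelSet S α) :
    (⨆ y : S, (samuelRank y - 1 + 1)) ≤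
      ⨆ y : S, (samuelRank (((0 : R), y) : R × S) - samuelRank (((0 : R), (1 : S)) : R × S) + 1) := by
  refine Ordinal.iSup_le fun y ↦ ?_
  by_cases hy : y = 0
  · subst hy
    rw [samuelRank_zero, Ordinal.zero_sub, zero_add]
    refine le_trans ?_ (Ordinal.le_iSup (fun y : S ↦
      samuelRank (((0 : R), y) : R × S) - samuelRank (((0 : R), (1 : S)) : R × S) + 1) 1)
    rw [Ordinal.sub_self, zero_add]
  · exact (add_le_add (samuelRank_sub_one_le_sub hR hS hy) le_rfl).trans (Ordinal.le_iSup (fun y : S ↦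
      samuelRank (((0 : R), y) : R × S) - samuelRank (((0 : R), (1 : S)) : R × S) + 1) y)

/-- Ordinal bookkeeping for «`e(R) = φ_R((0,1)) + ψ(0)`»: `(B − 1) + (T − B) = T − 1` for `1 ≤ B ≤ T`. [folklore] -/
private theorem sub_one_add_sub {B T : Ordinal.{u}} (h1 : 1 ≤ B) (h2 : B ≤ T) : (B - 1) + (T - B) = T - 1 :=
  (Ordinal.sub_eq_of_add_eq (by rw [← add_assoc, Ordinal.add_sub_cancel_of_le h1, Ordinal.add_sub_cancel_of_le h2])).symm

/-- **PRODUCT THEOREM, lower bound: `e(R) + e(S) ≤ e(R × S)`** for non-trivial commutative rings `R`, `S` exhausted by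
their transfinite constructions (i.e. Euclidean for ordinal-valued algorithms), `e(·) = ⨆_z ((θ z − 1) + 1)` the Euclidean
order type. [cite: Clark2015EuclideanOrderTypes, Thm. 22 (b) (lower bound)] -/
theorem iSup_samuelRank_add_iSup_samuelRank_le_prod [Nontrivial R] [Nontrivial S]
    (hR : ∀ x : R, ∃ α : Ordinal.{u}, x ∈ samuelSet R α) (hS : ∀ y : S, ∃ α : Ordinal.{u}, y ∈ samuelSet S α) :
    (⨆ x : R, (samuelRank x - 1 + 1)) + (⨆ y : S, (samuelRank y - 1 + 1)) ≤
      ⨆ z : R × S, (samuelRank z - 1 + 1) := by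
  set B : Ordinal.{u} := samuelRank (((0 : R), (1 : S)) : R × S) with hB
  have h1B : 1 ≤ B := by
    have h2 : (2 : Ordinal.{u}) ≤ B := by
      rw [hB, samuelRank_zero_mk_of_isUnit isUnit_one hR hS]
      have := Ordinal.le_iSup (fun c : R ↦ samuelRank c + 1) 1
      rwa [samuelRank_eq_one_iff_isUnit.2 isUnit_one, one_add_one_eq_two] at this
    exact one_le_two.trans h2
  refine (add_le_add (iSup_samuelRank_le_samuelRank_zero_one_sub_one hR hS)
    (iSup_samuelRank_le_iSup_sub_add_one hR hS)).trans ?_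
  rw [Ordinal.add_iSup]
  refine Ordinal.iSup_le fun y ↦ ?_
  by_cases hy : y = 0
  · -- the term `y = 0`: `(B − 1) + (0 − B) + 1 = (θ(0,1) − 1) + 1`
    subst hy
    rw [show (((0 : R), (0 : S)) : R × S) = 0 from rfl, samuelRank_zero, Ordinal.zero_sub, zero_add]
    exact Ordinal.le_iSup (fun z : R × S ↦ samuelRank z - 1 + 1) (((0 : R), (1 : S)) : R × S)
  · rw [← add_assoc, sub_one_add_sub h1B (samuelRank_zero_one_le hR hS hy)]
    exact Ordinal.le_iSup (fun z : R × S ↦ samuelRank z - 1 + 1) (((0 : R), y) : R × S)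

/-! ## §3 Consequences: products with a factor of order type `≥ ω` need transfinite algorithms -/

/-- If `e(S) ≥ ω` then `θ(u, 0) ≥ ω` for every unit `u` of `R` (`θ(u,0) = ⨆_c (θ_S(c) + 1) ≥ e(S)`).
[cite: Clark2015EuclideanOrderTypes, Thm. 19 (b), Thm. 22; Samuel1971, §3 Remark (2) (p. 287)] -/
theorem omega0_le_samuelRank_mk_zero_of_isUnit [Nontrivial R] {u : R} (hu : IsUnit u)
    (hS : ∀ y : S, ∃ α : Ordinal.{u}, y ∈ samuelSet S α) (hω : ω ≤ ⨆ y : S, (samuelRank y - 1 + 1)) :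
    ω ≤ samuelRank ((u, 0) : R × S) := by
  rw [samuelRank_mk_zero_of_isUnit hu hS]
  exact hω.trans (Ordinal.iSup_le fun y ↦
    (add_le_add (Ordinal.sub_le_self _ _) le_rfl).trans (Ordinal.le_iSup (fun y : S ↦ samuelRank y + 1) y))

/-- **No `ℕ`-valued algorithm on `R × S` when `e(S) ≥ ω`** (Samuel's Definition 1 with `W = ℕ`): `θ ≤ φ` for every
algorithm, but `θ(1, 0) ≥ ω`. [cite: Samuel1971, §3 Remark (2) (pp. 286–287); Clark2015EuclideanOrderTypes, Thm. 22 and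
Cor. 26 (Fletcher)] -/
theorem not_exists_algorithm_nat_of_omega0_le_iSup [Nontrivial R]
    (hS : ∀ y : S, ∃ α : Ordinal.{u}, y ∈ samuelSet S α) (hω : ω ≤ ⨆ y : S, (samuelRank y - 1 + 1)) :
    ¬∃ φ : R × S → ℕ, ∀ a b : R × S, b ≠ 0 → ∃ q r : R × S, a = b * q + r ∧ φ r < φ b := by
  rintro ⟨φ, hφ⟩
  have h := samuelRank_le_natCast φ hφ (((1 : R), (0 : S)) : R × S)
  exact not_lt.2 ((omega0_le_samuelRank_mk_zero_of_isUnit isUnit_one hS hω).trans h)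
    (Ordinal.natCast_lt_omega0 _)

/-- The same in Motzkin's form (`a = bq + s`, `s = 0` or `φ s < φ b`): `R × S` is NOT Euclidean for any ordinary Euclidean
function when `e(S) ≥ ω`. [cite: Samuel1971, §3 Remark (2) (pp. 286–287); Clark2015EuclideanOrderTypes, Thm. 22] -/
theorem not_exists_euclideanFunction_of_omega0_le_iSup [Nontrivial R]
    (hS : ∀ y : S, ∃ α : Ordinal.{u}, y ∈ samuelSet S α) (hω : ω ≤ ⨆ y : S, (samuelRank y - 1 + 1)) :
    ¬∃ φ : R × S → ℕ, ∀ a b : R × S, b ≠ 0 → ∃ q s : R × S, a = b * q + s ∧ (s = 0 ∨ φ s < φ b) := by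
  intro h
  have hu := exists_euclideanFunction_iff_iUnion_samuelSet_natCast.1 h
  obtain ⟨n, hn⟩ := Set.mem_iUnion.1 (Set.eq_univ_iff_forall.1 hu (((1 : R), (0 : S)) : R × S))
  exact not_lt.2 ((omega0_le_samuelRank_mk_zero_of_isUnit isUnit_one hS hω).trans (samuelRank_le_of_mem hn))
    (Ordinal.natCast_lt_omega0 n)

end Product

/-! ### Euclidean domains that are not fields: `e ≥ ω` -/

section Domain

/-- A non-field ring exhausted by its construction has `e ≥ 2`: a non-zero non-unit `x` has `θ(x) ≥ 2`.
[cite: Clark2015EuclideanOrderTypes, §2.5 (the bottom function vanishes exactly at the units); Samuel1971, §4 (4.2) (p. 288)] -/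
theorem two_le_iSup_samuelRank {R : Type u} [CommRing R] (h : ∀ z : R, ∃ α : Ordinal.{u}, z ∈ samuelSet R α)
    {x : R} (hx : x ≠ 0) (hxu : ¬IsUnit x) : (2 : Ordinal.{u}) ≤ ⨆ z : R, (samuelRank z - 1 + 1) := by
  have h0 : samuelRank x ≠ 0 := (samuelRank_pos (h x) hx).ne'
  have h1 : samuelRank x ≠ 1 := fun h1 ↦ hxu (samuelRank_eq_one_iff.1 h1).2
  have h01 : (1 : Ordinal.{u}) ≤ samuelRank x := Order.one_le_iff_ne_zero.2 h0
  have h2 : (2 : Ordinal.{u}) ≤ samuelRank x := by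
    by_contra hlt
    have : samuelRank x ≤ 1 := Order.le_of_lt_add_one (by rw [one_add_one_eq_two]; exact not_le.1 hlt)
    exact h1 (le_antisymm this h01)
  have h11 : (1 : Ordinal.{u}) ≤ samuelRank x - 1 :=
    (Ordinal.le_sub_of_le h01).2 (by rw [one_add_one_eq_two]; exact h2)
  have := Order.add_one_le_iff.2 (h11.trans_lt (samuelRank_sub_one_lt_iSup x))
  rwa [one_add_one_eq_two] at this

/-- **A domain exhausted by its transfinite construction which is not a field has Euclidean order type `≥ ω`**: its order
type is `ω^a` (`iSup_samuelRank_eq_omega0_opow`) and `≥ 2`, so `a ≥ 1`. [cite: Clark2015EuclideanOrderTypes, Thm. 25 (b),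
(c) and Cor. 26 (Fletcher); ConidisNielsenTombs2019, Cor. 6] -/
theorem omega0_le_iSup_samuelRank_of_not_isUnit {R : Type u} [CommRing R] [IsDomain R]
    (h : ∀ z : R, ∃ α : Ordinal.{u}, z ∈ samuelSet R α) {x : R} (hx : x ≠ 0) (hxu : ¬IsUnit x) :
    ω ≤ ⨆ z : R, (samuelRank z - 1 + 1) := by
  have h2 := two_le_iSup_samuelRank h hx hxu
  have he := iSup_samuelRank_eq_omega0_opow h
  have ha : Ordinal.log ω (⨆ z : R, (samuelRank z - 1 + 1)) ≠ 0 := by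
    intro ha
    rw [ha, Ordinal.opow_zero] at he
    rw [he] at h2
    exact absurd h2 (not_le.2 (by exact_mod_cast (by norm_num : (1 : ℕ) < 2)))
  rw [he]
  calc ω = ω ^ (1 : Ordinal.{u}) := (Ordinal.opow_one ω).symm
    _ ≤ ω ^ Ordinal.log ω (⨆ z : R, (samuelRank z - 1 + 1)) :=
        Ordinal.opow_le_opow_right Ordinal.omega0_pos (Order.one_le_iff_ne_zero.2 ha)

/-- A Mathlib `EuclideanDomain` that is not a field has `e ≥ ω`. [cite: Clark2015EuclideanOrderTypes, Thm. 25 (c) and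
Cor. 26 (Fletcher); ConidisNielsenTombs2019, §1 («fields have Euclidean order type ω⁰ = 1, non-fields ω¹ = ω» for
finitely valued domains)] -/
theorem omega0_le_iSup_samuelRank_of_euclideanDomain {S : Type u} [EuclideanDomain S]
    (hS : ∃ x : S, x ≠ 0 ∧ ¬IsUnit x) : ω ≤ ⨆ z : S, (samuelRank z - 1 + 1) := by
  obtain ⟨x, hx, hxu⟩ := hS
  exact omega0_le_iSup_samuelRank_of_not_isUnit forall_exists_mem_samuelSet_of_euclideanDomain hx hxu

/-- **A product `R × S` with `S` a non-field Euclidean domain admits NO `ℕ`-valued algorithm** (Samuel's «transfinite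
valued algorithms … unavoidable» for `ℤ × ℤ`, for every such product: `ℤ × ℤ[i]`, `k[X] × k[X]`, `R × ℤ` …).
[cite: Samuel1971, §3 Remark (2) (pp. 286–287); Clark2015EuclideanOrderTypes, Thm. 22, Thm. 25 (c), Cor. 26] -/
theorem not_exists_algorithm_nat_prod_of_euclideanDomain {R S : Type u} [CommRing R] [Nontrivial R] [EuclideanDomain S]
    (hS : ∃ x : S, x ≠ 0 ∧ ¬IsUnit x) :
    ¬∃ φ : R × S → ℕ, ∀ a b : R × S, b ≠ 0 → ∃ q r : R × S, a = b * q + r ∧ φ r < φ b :=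
  not_exists_algorithm_nat_of_omega0_le_iSup forall_exists_mem_samuelSet_of_euclideanDomain
    (omega0_le_iSup_samuelRank_of_euclideanDomain hS)

/-- … nor an ordinary Euclidean function in Motzkin's form. [cite: Samuel1971, §3 Remark (2) (pp. 286–287);
Clark2015EuclideanOrderTypes, Thm. 22, Cor. 26] -/
theorem not_exists_euclideanFunction_prod_of_euclideanDomain {R S : Type u} [CommRing R] [Nontrivial R]
    [EuclideanDomain S] (hS : ∃ x : S, x ≠ 0 ∧ ¬IsUnit x) :
    ¬∃ φ : R × S → ℕ, ∀ a b : R × S, b ≠ 0 → ∃ q s : R × S, a = b * q + s ∧ (s = 0 ∨ φ s < φ b) :=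
  not_exists_euclideanFunction_of_omega0_le_iSup forall_exists_mem_samuelSet_of_euclideanDomain
    (omega0_le_iSup_samuelRank_of_euclideanDomain hS)

/-- … although the product of two Euclidean domains IS Euclidean for an ordinal-valued algorithm (Prop. 6).
[cite: Samuel1971, Prop. 6 (p. 285); Clark2015EuclideanOrderTypes, Thm. 22 (a)] -/
theorem exists_ordinal_algorithm_prod_of_euclideanDomain {R S : Type u} [EuclideanDomain R] [EuclideanDomain S] :
    ∃ φ : R × S → Ordinal.{u}, ∀ a b : R × S, b ≠ 0 → ∃ q r : R × S, a = b * q + r ∧ φ r < φ b :=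
  ⟨samuelRank, samuelRank_isAlgorithm (Prod.forall_exists_mem_samuelSet
    forall_exists_mem_samuelSet_of_euclideanDomain forall_exists_mem_samuelSet_of_euclideanDomain)⟩

/-- **«`e(R′) ≥ rω`» for `r = 2`**: the product of two non-field Euclidean domains has Euclidean order type `≥ ω + ω`.
[cite: Clark2015EuclideanOrderTypes, Thm. 25 (c) and Thm. 22 (b)] -/
theorem omega0_add_omega0_le_iSup_samuelRank_prod {R S : Type u} [EuclideanDomain R] [EuclideanDomain S]
    (hR : ∃ x : R, x ≠ 0 ∧ ¬IsUnit x) (hS : ∃ y : S, y ≠ 0 ∧ ¬IsUnit y) :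
    ω + ω ≤ ⨆ z : R × S, (samuelRank z - 1 + 1) :=
  (add_le_add (omega0_le_iSup_samuelRank_of_euclideanDomain hR) (omega0_le_iSup_samuelRank_of_euclideanDomain hS)).trans
    (iSup_samuelRank_add_iSup_samuelRank_le_prod forall_exists_mem_samuelSet_of_euclideanDomain
      forall_exists_mem_samuelSet_of_euclideanDomain)

end Domain

end Literature.Algebra.EuclideanDomain
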